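import Literature.NumberTheory.LFunctions.HalaszRestrictedWindowSq
import HarnessLib

/-!
# Matomäki–Radziwiłł–Tao (2015), Proposition A.3: the window around the minimiser in `L²` (unconditional)

Topic `Literature/NumberTheory/LFunctions`.  Everything in this file is PROVED; no definitions, no named facts.

Companion of `MatomakiRadziwillTaoPropA3Window.lean`.  That file bounds the contribution of
`𝒯₀ ∪ 𝒯₁ = {|t - t₁| ≤ (log X)^{1/16}}` to `∫ |F(1+it)|²` (`F = MRT2015.restrDirichlet f I X`, the `𝒮`-restricted
polynomial of Proposition A.3) through POINTWISE bounds for `F`, conditionally on Khale's zero-free region, with the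
middle term `(1+M) e^{-M/2}`, `M = M(f;X)`; fed into the major arcs this only gives Theorem 1.7 of the paper with the
rate `e^{-M/120}` (`MRT2015.theorem17With_of_A2With`).  Here the window is treated in `L²` (Gallagher's lemma and the
window form of the restricted Halász theorem, `Halasz.Restricted.integral_sq_restr_dirichlet_window_sq_le`):

* `MRT2015.integral_sq_restrDirichlet_window_le_sq` — UNCONDITIONALLY, for all large `X`, `0 < η ≤ 1`,
  `I : SieveIntervalSystem η X₀` with `√X ≤ X₀ ≤ X`, completely multiplicative `1`-bounded `f`, every `t₁` and every
  `[a,b] ⊆ [t₁ - (log X)^{1/16}, t₁ + (log X)^{1/16}] ∩ [-X/2, X/2]`: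
  `∫_a^b |F(1+it)|² dt ≤ K ((1+M)² e^{-M} + (log X)^{-1/50})`.

With the `𝒯₂` bound of `MatomakiRadziwillTaoT2.lean` this gives `MRT2015.PropA3With (fun M => K (1+M)² e^{-M})` and
hence Theorem 1.7 AS PRINTED (rate `e^{-M(g;X,Q)/20}`) from Khale's theorem (`MatomakiRadziwillTaoTheorem17OfKhale.lean`,
via `MRT2015.theorem17_of_propA3With_sq`).

Also: `Halasz.Restricted.minHalfDistSq_twist_ge_half_min_quarter` (`M(y,X)/2 ≤ M_½(g n^{-it}; y, X/4)` for
`|t| ≤ 3X/4`), `Halasz.Restricted.minPretentiousDistSq_height_le` (`M(X,T) ≤ M(y,T) + 2` for `y ≥ X - 1`),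
`MRT2015.card_biUnion_primeBlock_le`, the error-term bookkeeping `MRT2015.windowSq_errTerms_le` (`≤ 42 e^{-λ/100}`,
`λ = log log X`) and `MRT2015.sq_peak_le` (`((1+M₀)e^{-M₀})² ≤ 3(1+M)²e^{-M}`, `M₀ = max(0, M/2 - 1)`).

## References
* K. Matomäki, M. Radziwiłł, T. Tao, *An averaged form of Chowla's conjecture*, Algebra & Number Theory 9 (2015),
  Appendix A, Proposition A.3 and its proof (the ranges `𝒯₀`, `𝒯₁`).
  [cite: MatomakiRadziwillTao2015, Appendix A, Proposition A.3 (proof)]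

## Design choices
* Same interface as `MRT2015.integral_sq_restrDirichlet_window_le` minus the (unneeded) minimiser hypothesis and the
  Khale hypothesis; the window theorem enters through the hypothesis of `…_of` and is instantiated once.
  Parameters: `L_w = (log X)^{1/16}`, `δ₀ = L_w^{-1} (log X)^{-1/100}`, `Q = exp(√log X)`, `M₀ = max(0, M/2 - 1)`.
-/

noncomputable section

open Finset Real Complex Filter MeasureTheory
open scoped ComplexConjugate Classical

namespace Literature.NumberTheory.LFunctions

namespace Halasz

namespace Restricted

variable {g : ℕ → ℂ}

/-- For `|t| ≤ 3X/4` and every height `y`: `M(y, X)/2 ≤ M_½(g · n^{-it}; y, X/4)` — the twists `n^{i(t+u)}`,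
`|u| ≤ X/4`, stay in the window `|t + u| ≤ X` of `M(y, X)`, and `𝔻_½² ≥ 𝔻²/2` (the proof of
`minHalfDistSq_twist_ge_half_min` with `X/4` for `X/2`). [folklore] -/
theorem minHalfDistSq_twist_ge_half_min_quarter (hgb : ∀ n, ‖g n‖ ≤ 1) (E : Finset ℕ) {X t : ℝ} (hX : 0 ≤ X)
    (ht : |t| ≤ 3 * X / 4) (y : ℝ) :
    Sieve.minPretentiousDistSq g y X / 2 ≤
      minHalfDistSq E (fun n : ℕ => g n * (n : ℂ) ^ (-((t : ℂ) * I))) y (X / 4) := by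
  have hX2 : 0 ≤ X / 4 := by linarith
  have hne : Nonempty (Set.Icc (-(X / 4)) (X / 4)) := ⟨⟨0, by simp [hX2]⟩⟩
  unfold minHalfDistSq
  refine le_ciInf fun u => ?_
  rw [halfDistSq_mul_twist]
  have hu : |(u : ℝ)| ≤ X / 4 := abs_le.2 ⟨u.2.1, u.2.2⟩
  have htu : |t + (u : ℝ)| ≤ X := by
    have := abs_add_le t (u : ℝ); linarith
  have h1 := minPretentiousDistSq_le_of_abs_le hgb y htu
  have h2 := halfDistSq_ge_half hgb E (t + (u : ℝ)) y
  linarith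

/-- Heights `y ≥ X - 1` (`X ≥ 4`): `M(X, T) ≤ M(y, T) + 2` (`T ≥ 0`). [folklore] -/
theorem minPretentiousDistSq_height_le (hgb : ∀ n, ‖g n‖ ≤ 1) {X T y : ℝ} (hX : 4 ≤ X) (hT : 0 ≤ T)
    (hy1 : X - 1 ≤ y) :
    Sieve.minPretentiousDistSq g X T ≤ Sieve.minPretentiousDistSq g y T + 2 := by
  rcases le_or_gt X y with hXy | hyX
  · have := minPretentiousDistSq_mono_height hgb hT hXy (g := g); linarith
  · have h1 := minPretentiousDistSq_le_add_tail hgb hT hyX.le (g := g)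
    have h2 : ∑ p ∈ (Finset.Ioc ⌊y⌋₊ ⌊X⌋₊).filter Nat.Prime, (1 : ℝ) / p ≤ 1 := by
      refine (sum_inv_prime_Ioc_le (by linarith) hyX.le).trans ?_
      rw [div_le_one (by linarith)]; linarith
    linarith

end Restricted

end Halasz

namespace MRT2015

open Sieve (SieveIntervalSystem minPretentiousDistSq minPretentiousDistSq_nonneg pretentiousDistSq)
open Halasz.Restricted (MemBlocks IsBlockSystem minHalfDistSq)

variable {η X₀ : ℝ}

/-- The union of the blocks of primes `[P_j, Q_j]` has at most `Q_J` elements (`0 < η ≤ 8`). [folklore] -/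
theorem card_biUnion_primeBlock_le (I : SieveIntervalSystem η X₀) (hη : 0 < η) (hη' : η ≤ 8) :
    (((Finset.Icc 1 I.J).biUnion fun j => (Finset.Icc ⌈I.P j⌉₊ ⌊I.Q j⌋₊).filter Nat.Prime).card : ℝ) ≤ I.Q I.J := by
  have hsub : ((Finset.Icc 1 I.J).biUnion fun j => (Finset.Icc ⌈I.P j⌉₊ ⌊I.Q j⌋₊).filter Nat.Prime) ⊆
      Finset.Icc 1 ⌊I.Q I.J⌋₊ := by
    intro p hp
    rw [Finset.mem_biUnion] at hp
    obtain ⟨j, hj, hpj⟩ := hp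
    rw [Finset.mem_Icc] at hj
    rw [mem_primeBlock_iff I hj.1] at hpj
    rw [Finset.mem_Icc]
    exact ⟨hpj.1.one_lt.le, Nat.le_floor (hpj.2.2.trans (Q_le_Q_J I hη hη' hj.1 hj.2))⟩
  have hQ0 : 0 < I.Q I.J := I.pos_Q I.one_le_J
  calc (((Finset.Icc 1 I.J).biUnion fun j => (Finset.Icc ⌈I.P j⌉₊ ⌊I.Q j⌋₊).filter Nat.Prime).card : ℝ)
      ≤ ((Finset.Icc 1 ⌊I.Q I.J⌋₊).card : ℝ) := by exact_mod_cast Finset.card_le_card hsub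
    _ = ⌊I.Q I.J⌋₊ := by rw [Nat.card_Icc]; simp
    _ ≤ I.Q I.J := Nat.floor_le hQ0.le

/-- **The error terms of the squared window bound are `≪ (log X)^{-1/100}`.**  With `λ = log log X ≥ 0`,
`L = e^{λ/16}`, `δ₀ = e^{-(λ/16 + λ/100)}`: if `J + 1 ≤ 3 + λ`, `ρ₁ ≤ 2 e^{-λ/4}`, `1/√ℓ₁ ≤ √2 e^{-λ/2}`,
`L/ℓ₁ ≤ 2 e^{-15λ/16}` and `L(|E|+15)/X ≤ 4 e^{-15λ/16}`, then
`(J+1)ρ₁ + (J+1)L δ₀^{-1/12}/√ℓ₁ + L/ℓ₁ + L(|E|+15)/X + Lδ₀ ≤ 42 e^{-λ/100}`. [folklore] -/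
theorem windowSq_errTerms_le {lam Jr ρ₁ s c d : ℝ} (hlam : 0 ≤ lam) (hJr : Jr ≤ 3 + lam)
    (hρ₀ : 0 ≤ ρ₁) (hρ : ρ₁ ≤ 2 * Real.exp (-(lam / 4)))
    (hs0 : 0 ≤ s) (hs : s ≤ Real.sqrt 2 * Real.exp (-(lam / 2)))
    (hc : c ≤ 2 * Real.exp (-(15 / 16 * lam))) (hd : d ≤ 4 * Real.exp (-(15 / 16 * lam))) :
    Jr * ρ₁ + Jr * Real.exp (lam / 16) * (Real.exp (-(lam / 16 + lam / 100))) ^ (-(1 / 12 : ℝ)) * s + c + d +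
      Real.exp (lam / 16) * Real.exp (-(lam / 16 + lam / 100)) ≤ 42 * Real.exp (-(lam / 100)) := by
  set E : ℝ := Real.exp (-(lam / 100)) with hE
  have hE0 : 0 < E := Real.exp_pos _
  have hmono : ∀ c : ℝ, c ≤ -(lam / 100) → Real.exp c ≤ E := fun c hc => Real.exp_le_exp.2 hc
  have hJr' : Jr ≤ 10 * Real.exp (lam / 10) := hJr.trans (three_add_le_exp lam)
  have hsqrt2 : Real.sqrt 2 ≤ 3 / 2 := by
    rw [show (3 / 2 : ℝ) = Real.sqrt ((3 / 2) ^ 2) by rw [Real.sqrt_sq (by norm_num)]]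
    exact Real.sqrt_le_sqrt (by norm_num)
  -- T1: `Jr ρ₁ ≤ 20 e^{λ/10 - λ/4} ≤ 20 E`
  have hT1 : Jr * ρ₁ ≤ 20 * E := by
    have h1 : Jr * ρ₁ ≤ (10 * Real.exp (lam / 10)) * (2 * Real.exp (-(lam / 4))) :=
      mul_le_mul hJr' hρ hρ₀ (by positivity)
    have h2 : (10 * Real.exp (lam / 10)) * (2 * Real.exp (-(lam / 4))) = 20 * Real.exp (lam / 10 + -(lam / 4)) := by
      rw [Real.exp_add]; ring
    rw [h2] at h1
    exact h1.trans (mul_le_mul_of_nonneg_left (hmono _ (by linarith)) (by norm_num))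
  -- T2: the `δ₀^{-1/12}` term
  have hT2 : Jr * Real.exp (lam / 16) * (Real.exp (-(lam / 16 + lam / 100))) ^ (-(1 / 12 : ℝ)) * s ≤ 15 * E := by
    have hpow : (Real.exp (-(lam / 16 + lam / 100))) ^ (-(1 / 12 : ℝ)) = Real.exp ((lam / 16 + lam / 100) / 12) := by
      rw [← Real.exp_mul]; congr 1; ring
    rw [hpow]
    have h1 : Jr * Real.exp (lam / 16) * Real.exp ((lam / 16 + lam / 100) / 12) * s ≤
        (10 * Real.exp (lam / 10)) * Real.exp (lam / 16) * Real.exp ((lam / 16 + lam / 100) / 12) *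
          (Real.sqrt 2 * Real.exp (-(lam / 2))) := by
      have h0 : 0 ≤ Real.exp (lam / 16) * Real.exp ((lam / 16 + lam / 100) / 12) := by positivity
      calc Jr * Real.exp (lam / 16) * Real.exp ((lam / 16 + lam / 100) / 12) * s
          = Jr * (Real.exp (lam / 16) * Real.exp ((lam / 16 + lam / 100) / 12)) * s := by ring
        _ ≤ (10 * Real.exp (lam / 10)) * (Real.exp (lam / 16) * Real.exp ((lam / 16 + lam / 100) / 12)) *
            (Real.sqrt 2 * Real.exp (-(lam / 2))) :=
            mul_le_mul (mul_le_mul_of_nonneg_right hJr' h0) hs hs0 (by positivity)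
        _ = _ := by ring
    have h2 : (10 * Real.exp (lam / 10)) * Real.exp (lam / 16) * Real.exp ((lam / 16 + lam / 100) / 12) *
        (Real.sqrt 2 * Real.exp (-(lam / 2))) =
        10 * Real.sqrt 2 * Real.exp (lam / 10 + lam / 16 + (lam / 16 + lam / 100) / 12 + -(lam / 2)) := by
      rw [Real.exp_add, Real.exp_add, Real.exp_add]; ring
    rw [h2] at h1
    have h3 : 10 * Real.sqrt 2 ≤ 15 := by linarith
    have h4 : Real.exp (lam / 10 + lam / 16 + (lam / 16 + lam / 100) / 12 + -(lam / 2)) ≤ E := hmono _ (by nlinarith)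
    calc _ ≤ 10 * Real.sqrt 2 * Real.exp (lam / 10 + lam / 16 + (lam / 16 + lam / 100) / 12 + -(lam / 2)) := h1
      _ ≤ 15 * E := mul_le_mul h3 h4 (Real.exp_pos _).le (by norm_num)
  -- T3, T4
  have hT3 : c ≤ 2 * E := hc.trans (mul_le_mul_of_nonneg_left (hmono _ (by linarith)) (by norm_num))
  have hT4 : d ≤ 4 * E := hd.trans (mul_le_mul_of_nonneg_left (hmono _ (by linarith)) (by norm_num))
  -- T5
  have hT5 : Real.exp (lam / 16) * Real.exp (-(lam / 16 + lam / 100)) ≤ E := by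
    rw [← Real.exp_add, hE]; exact Real.exp_le_exp.2 (by linarith)
  linarith

/-- `((1 + M₀) e^{-M₀})² ≤ 3 (1 + M)² e^{-M}` for `M₀ = max(0, M/2 - 1)`, `M ≥ 0`. [folklore] -/
theorem sq_peak_le {M : ℝ} (hM : 0 ≤ M) :
    ((1 + max 0 (M / 2 - 1)) * Real.exp (-max 0 (M / 2 - 1))) ^ 2 ≤ 3 * ((1 + M) ^ 2 * Real.exp (-M)) := by
  rcases le_or_gt (M / 2 - 1) 0 with h | h
  · rw [max_eq_left h]
    simp only [add_zero, neg_zero, Real.exp_zero, mul_one, one_pow]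
    -- `M ≤ 2`: `(1 + M)² e^{-M} ≥ e^{-M} (1 + M)² ≥ ...`; crude: `e^{-M} ≥ e^{-2} ≥ 1/9` and `(1+M)² ≥ 1`... use `e^{M} ≤ e² ≤ 9 ≤ 3(1+M)²·3`
    have hM2 : M ≤ 2 := by linarith
    have hexp : Real.exp M ≤ 3 * (1 + M) ^ 2 := by
      have he1 := Real.exp_one_lt_d9
      rcases le_or_gt M 1 with hM1 | hM1
      · have h1 : Real.exp M ≤ Real.exp 1 := Real.exp_le_exp.2 hM1
        nlinarith
      · have h1 : Real.exp M ≤ Real.exp 2 := Real.exp_le_exp.2 hM2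
        have e2 : Real.exp 2 = Real.exp 1 * Real.exp 1 := by rw [← Real.exp_add]; norm_num
        have h2 : Real.exp 2 ≤ 8 := by rw [e2]; nlinarith [Real.exp_pos (1:ℝ)]
        nlinarith
    have hpos : 0 < Real.exp (-M) := Real.exp_pos _
    have hone : Real.exp M * Real.exp (-M) = 1 := by rw [← Real.exp_add]; simp
    nlinarith [mul_le_mul_of_nonneg_right hexp hpos.le]
  · rw [max_eq_right h.le]
    have e1 : 1 + (M / 2 - 1) = M / 2 := by ring
    rw [e1]
    have e2 : (M / 2 * Real.exp (-(M / 2 - 1))) ^ 2 = (Real.exp 2 / 4) * (M ^ 2 * Real.exp (-M)) := by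
      rw [mul_pow, ← Real.exp_nat_mul]
      have : ((2 : ℕ) : ℝ) * -(M / 2 - 1) = 2 + -M := by push_cast; ring
      rw [this, Real.exp_add]; ring
    rw [e2]
    have h3 : Real.exp 2 / 4 ≤ 3 := by
      have := Real.exp_one_lt_d9
      have e3 : Real.exp 2 = Real.exp 1 * Real.exp 1 := by rw [← Real.exp_add]; norm_num
      rw [e3]; nlinarith [Real.exp_pos (1:ℝ)]
    have h4 : M ^ 2 * Real.exp (-M) ≤ (1 + M) ^ 2 * Real.exp (-M) :=
      mul_le_mul_of_nonneg_right (by nlinarith) (Real.exp_pos _).le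
    have h5 : 0 ≤ M ^ 2 * Real.exp (-M) := by positivity
    nlinarith

set_option maxHeartbeats 1600000 in
/-- **The window `|t - t₁| ≤ (log X)^{1/16}` of Proposition A.3 for the restricted polynomial, in `L²`.**
Unconditional.  Given the block-system `L²` window bound (hypothesis `hW1`, the statement of
`Halasz.Restricted.integral_sq_restr_dirichlet_window_sq_le`), there is an absolute `K` such that for all large `X`,
every `0 < η ≤ 1`, every interval system `I : SieveIntervalSystem η X₀` with `√X ≤ X₀ ≤ X`, every completely
multiplicative `f` with `|f| ≤ 1`, every `t₁` and every `[a, b] ⊆ [t₁ - (log X)^{1/16}, t₁ + (log X)^{1/16}] ∩ [-X/2, X/2]`,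

`∫_a^b |F(1+it)|² dt ≤ K ((1 + M)² e^{-M} + (log X)^{-1/50})`,  `F(1+it) = MRT2015.restrDirichlet f I X t`,
`M = M(f; X) = min_{|u| ≤ X} 𝔻(f, n^{iu}; X)²`.

Compared with `integral_sq_restrDirichlet_window_le` (middle term `(1+M)e^{-M/2}`, conditional on Khale's
theorem through the pointwise bounds) the middle term is `(1+M)² e^{-M}`, which is what the major arcs of
Matomäki–Radziwiłł–Tao need for the printed rate `e^{-M/20}` of their Theorem 1.7
(`MRT2015.theorem17_of_propA3With_sq`). [cite: MatomakiRadziwillTao2015, Appendix A, Proposition A.3 (proof)] -/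
theorem integral_sq_restrDirichlet_window_le_sq_of
    (hW1 : ∃ K : ℝ, 0 < K ∧ ∀ (𝓙 : Finset ℕ) (blk : ℕ → Finset ℕ) (g : ℕ → ℂ),
      (∀ m n, g (m * n) = g m * g n) → g 1 = 1 → (∀ n, ‖g n‖ ≤ 1) →
      ∀ X Lw δ₀ Q t₁ M₀ : ℝ, 64 ≤ X → 16 ≤ Lw → Lw ≤ X / 8 → 0 < δ₀ → δ₀ ≤ 1 → Real.exp 2 ≤ Q →
      IsBlockSystem 𝓙 blk (⌈X⌉₊ - 1) → (∀ i ∈ 𝓙, ∀ p ∈ blk i, (p : ℝ) ≤ Q) → 0 ≤ M₀ →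
      (∀ y : ℝ, X - 1 ≤ y → y ≤ 2 * X →
        M₀ ≤ minHalfDistSq (𝓙.biUnion blk) (fun n : ℕ => g n * (n : ℂ) ^ (-((t₁ : ℂ) * Complex.I))) y (X / 4)) →
        ∫ t in (t₁ - Lw)..(t₁ + Lw),
            ‖∑ n ∈ (Finset.Icc ⌈X⌉₊ ⌊2 * X⌋₊).filter (MemBlocks 𝓙 blk),
              g n * (n : ℂ) ^ (-(1 + (t : ℂ) * Complex.I))‖ ^ 2 ≤
          K * (((1 + M₀) * Real.exp (-M₀)) ^ 2 +
            ((𝓙.card + 1) * Real.sqrt ((Real.log Q + 2) / Real.log (X - 1)) +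
              (𝓙.card + 1) * Lw * δ₀ ^ (-(1 / 12 : ℝ)) / Real.sqrt (Real.log (X - 1)) +
              Lw / Real.log (X - 1) + Lw * ((𝓙.biUnion blk).card + 15) / X + Lw * δ₀) ^ 2)) :
    ∃ K : ℝ, 0 < K ∧ ∀ᶠ X : ℝ in atTop, ∀ (η X₀ : ℝ) (I : SieveIntervalSystem η X₀) (f : ℕ → ℂ),
      0 < η → η ≤ 1 → (∀ m n, f (m * n) = f m * f n) → f 1 = 1 → (∀ n, ‖f n‖ ≤ 1) →
      Real.sqrt X ≤ X₀ → X₀ ≤ X →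
      ∀ (t₁ a b : ℝ),
        a ≤ b → t₁ - Real.log X ^ (1 / 16 : ℝ) ≤ a → b ≤ t₁ + Real.log X ^ (1 / 16 : ℝ) →
        -(X / 2) ≤ a → b ≤ X / 2 →
        ∫ t in a..b, ‖restrDirichlet f I X t‖ ^ 2 ≤
          K * ((1 + minPretentiousDistSq f X X) ^ 2 * Real.exp (-minPretentiousDistSq f X X) +
            1 / Real.log X ^ (1 / 50 : ℝ)) := by
  obtain ⟨K, hK0, hW⟩ := hW1
  refine ⟨K * 1764, by positivity, ?_⟩
  filter_upwards [eventually_ge_atTop (256 : ℝ), Real.tendsto_log_atTop.eventually_ge_atTop (16 : ℝ),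
    (Real.tendsto_log_atTop.comp Real.tendsto_log_atTop).eventually_ge_atTop (48 : ℝ)] with X hX256 hℓ16 hll
  intro η X₀ I f hη hη1 hf hf1 hfb hX₀ hX₀X t₁ a b hab ha hb haX hbX
  have hη8 : η ≤ 8 := by linarith
  have hX0 : 0 < X := by linarith
  have hX64 : (64 : ℝ) ≤ X := by linarith
  have hX4 : (4 : ℝ) ≤ X := by linarith
  set ℓ : ℝ := Real.log X with hℓdef
  set lam : ℝ := Real.log ℓ with hlamdef
  have hlam48 : 48 ≤ lam := hll
  have hℓ0 : 0 < ℓ := by linarith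
  have hℓ1 : 1 ≤ ℓ := by linarith
  have hℓ4 : 4 ≤ ℓ := by linarith
  have hlam0 : 0 ≤ lam := by linarith
  have hℓexp : ℓ = Real.exp lam := by rw [hlamdef, Real.exp_log hℓ0]
  -- the window length
  set L : ℝ := ℓ ^ (1 / 16 : ℝ) with hLdef
  have hLexp : L = Real.exp (lam / 16) := by
    rw [hLdef, Real.rpow_def_of_pos hℓ0, hlamdef]; ring_nf
  have he3 : (16 : ℝ) ≤ Real.exp 3 := by
    have h := Real.exp_one_gt_d9
    have h3 : Real.exp 3 = Real.exp 1 ^ 3 := by rw [← Real.exp_nat_mul]; norm_num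
    have h4 : (2.7182818283 : ℝ) ^ 3 ≤ Real.exp 1 ^ 3 := pow_le_pow_left₀ (by norm_num) h.le 3
    rw [h3]; exact le_trans (by norm_num) h4
  have h16L : 16 ≤ L := by
    rw [hLexp]; exact he3.trans (Real.exp_le_exp.2 (by linarith))
  have hL0 : 0 < L := by linarith
  have hsX16 : 16 ≤ Real.sqrt X := by
    rw [show (16 : ℝ) = Real.sqrt 256 by rw [show (256:ℝ) = 16 ^ 2 by norm_num, Real.sqrt_sq (by norm_num)]]
    exact Real.sqrt_le_sqrt hX256
  have hLℓ : L ≤ ℓ := by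
    rw [hLdef]
    calc ℓ ^ (1 / 16 : ℝ) ≤ ℓ ^ (1 : ℝ) := Real.rpow_le_rpow_of_exponent_le hℓ1 (by norm_num)
      _ = ℓ := Real.rpow_one ℓ
  have hℓX : ℓ ≤ 2 * Real.sqrt X := by
    have h2 : ℓ ≤ X ^ (1 / 2 : ℝ) / (1 / 2) := Real.log_le_rpow_div hX0.le (by norm_num)
    rw [← Real.sqrt_eq_rpow] at h2; linarith
  have hLX8 : L ≤ X / 8 := by
    have : 2 * Real.sqrt X ≤ X / 8 := by nlinarith [Real.mul_self_sqrt hX0.le, Real.sqrt_nonneg X]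
    linarith
  have hLX4 : L ≤ X / 4 := by linarith
  -- the block system of `I` and the bound `Q = exp(√ log X)`
  set Q : ℝ := Real.exp (Real.sqrt ℓ) with hQdef
  have hs2 : 2 ≤ Real.sqrt ℓ := by
    rw [show (2 : ℝ) = Real.sqrt 4 by rw [show (4:ℝ) = 2 ^ 2 by norm_num, Real.sqrt_sq (by norm_num)]]
    exact Real.sqrt_le_sqrt hℓ4
  have hQ2 : Real.exp 2 ≤ Q := Real.exp_le_exp.2 hs2
  have hQ5 : 5 ≤ Q := by
    have e2 : Real.exp 2 = Real.exp 1 * Real.exp 1 := by rw [← Real.exp_add]; norm_num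
    have := Real.exp_one_gt_d9
    have : (5 : ℝ) ≤ Real.exp 2 := by rw [e2]; nlinarith
    linarith
  have hsX : 0 < Real.sqrt X := Real.sqrt_pos.2 hX0
  have hX₀0 : 0 < X₀ := hsX.trans_le hX₀
  have hQJ : I.Q I.J ≤ Q :=
    I.Q_J_le.trans (Real.exp_le_exp.2 (Real.sqrt_le_sqrt (Real.log_le_log hX₀0 hX₀X)))
  have hsqℓ : Real.sqrt ℓ ≤ ℓ / 2 := by nlinarith [Real.mul_self_sqrt hℓ0.le, Real.sqrt_nonneg ℓ, hs2]
  have hexpℓ2 : Real.exp (ℓ / 2) = Real.sqrt X := by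
    rw [Real.sqrt_eq_rpow, Real.rpow_def_of_pos hX0, hℓdef]; ring_nf
  have hQsX : Q ≤ Real.sqrt X := by
    calc Q ≤ Real.exp (ℓ / 2) := Real.exp_le_exp.2 hsqℓ
      _ = Real.sqrt X := hexpℓ2
  have hsqX1 : Real.sqrt X ≤ X - 1 := by nlinarith [Real.mul_self_sqrt hX0.le, hsX16]
  have hQX1 : Q ≤ X - 1 := hQsX.trans hsqX1
  have hN : I.Q I.J ≤ ((⌈X⌉₊ - 1 : ℕ) : ℝ) := by
    have h1 : 1 ≤ ⌈X⌉₊ := Nat.one_le_iff_ne_zero.2 (by simpa using hX0)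
    rw [Nat.cast_sub h1, Nat.cast_one]
    have h2 : X ≤ ⌈X⌉₊ := Nat.le_ceil X
    linarith
  have hsys := isBlockSystem I hη hη8 hN
  have hblkQ : ∀ i ∈ Finset.Icc 1 I.J, ∀ p ∈ (Finset.Icc ⌈I.P i⌉₊ ⌊I.Q i⌋₊).filter Nat.Prime, (p : ℝ) ≤ Q :=
    fun i hi p hp => (primeBlock_le_Q_J I hη hη8 i hi p hp).trans hQJ
  -- the threshold `δ₀` and the lower bound `M₀`
  set δ₀ : ℝ := Real.exp (-(lam / 16 + lam / 100)) with hδ₀def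
  have hδ₀ : 0 < δ₀ := Real.exp_pos _
  have hδ₁ : δ₀ ≤ 1 := by rw [hδ₀def]; exact Real.exp_le_one_iff.2 (by linarith)
  set M : ℝ := minPretentiousDistSq f X X with hMdef
  have hM0 : 0 ≤ M := minPretentiousDistSq_nonneg hfb X hX0.le
  set M₀ : ℝ := max 0 (M / 2 - 1) with hM₀def
  have hM₀0 : 0 ≤ M₀ := le_max_left _ _
  have ht₁ : |t₁| ≤ 3 * X / 4 := by
    rw [abs_le]; constructor <;> linarith
  set E : Finset ℕ := (Finset.Icc 1 I.J).biUnion fun j => (Finset.Icc ⌈I.P j⌉₊ ⌊I.Q j⌋₊).filter Nat.Prime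
    with hEdef
  have hM₀ : ∀ y : ℝ, X - 1 ≤ y → y ≤ 2 * X → M₀ ≤ minHalfDistSq E
      (fun n : ℕ => f n * (n : ℂ) ^ (-((t₁ : ℂ) * Complex.I))) y (X / 4) := by
    intro y hy1 _
    have h1 := Halasz.Restricted.minHalfDistSq_twist_ge_half_min_quarter hfb E hX0.le ht₁ y
    have h2 := Halasz.Restricted.minPretentiousDistSq_height_le hfb hX4 hX0.le hy1 (T := X) (g := f)
    have h3 := Halasz.Restricted.minHalfDistSq_nonneg (Halasz.Restricted.norm_mul_twist_le hfb t₁) E y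
      (by linarith : (0 : ℝ) ≤ X / 4)
    refine max_le h3 ?_
    rw [hMdef]; linarith
  -- the block-level bound
  have hmain := hW (Finset.Icc 1 I.J) (fun j => (Finset.Icc ⌈I.P j⌉₊ ⌊I.Q j⌋₊).filter Nat.Prime) f hf hf1 hfb
    X L δ₀ Q t₁ M₀ hX64 h16L hLX8 hδ₀ hδ₁ hQ2 hsys hblkQ hM₀0 hM₀
  have hEq : ∀ t : ℝ, restrDirichlet f I X t = ∑ n ∈ (Finset.Icc ⌈X⌉₊ ⌊2 * X⌋₊).filter
      (MemBlocks (Finset.Icc 1 I.J) (fun j => (Finset.Icc ⌈I.P j⌉₊ ⌊I.Q j⌋₊).filter Nat.Prime)),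
        f n * (n : ℂ) ^ (-(1 + (t : ℂ) * Complex.I)) := fun t => restrDirichlet_eq_sum_memBlocks f I hX0 t
  -- `∫_a^b ≤ ∫_{t₁-L}^{t₁+L}`
  have hmono : ∫ t in a..b, ‖restrDirichlet f I X t‖ ^ 2 ≤
      ∫ t in (t₁ - L)..(t₁ + L), ‖restrDirichlet f I X t‖ ^ 2 := by
    refine intervalIntegral.integral_mono_interval ha hab hb
      (Filter.Eventually.of_forall fun t => by positivity) ?_
    exact ((continuous_restrDirichlet f I X).norm.pow 2).intervalIntegrable _ _
  refine hmono.trans ?_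
  simp_rw [hEq]
  refine hmain.trans ?_
  clear hmain hEq hmono hW hsys hblkQ hM₀ hN
  -- the error terms
  set ℓ₁ : ℝ := Real.log (X - 1) with hℓ₁def
  set Jr : ℝ := ((Finset.Icc 1 I.J).card : ℝ) + 1 with hJrdef
  set ρ₁ : ℝ := Real.sqrt ((Real.log Q + 2) / ℓ₁) with hρ₁def
  set s : ℝ := 1 / Real.sqrt ℓ₁ with hsdef
  set c : ℝ := L / ℓ₁ with hcdef
  set d : ℝ := L * (E.card + 15) / X with hddef
  have hℓ₁ℓ : ℓ / 2 ≤ ℓ₁ := by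
    rw [hℓ₁def, hℓdef]
    have h2 : Real.log (Real.sqrt X) = Real.log X / 2 := by
      rw [Real.sqrt_eq_rpow, Real.log_rpow hX0]; ring
    rw [← h2]; exact Real.log_le_log hsX hsqX1
  have hℓ₁0 : 0 < ℓ₁ := by linarith
  have hJr0 : 0 ≤ Jr := by
    have : (0 : ℝ) ≤ (Finset.Icc 1 I.J).card := Nat.cast_nonneg _
    rw [hJrdef]; linarith
  have hJr : Jr ≤ 3 + lam := by
    have hcard : ((Finset.Icc 1 I.J).card : ℝ) = I.J := by rw [Nat.card_Icc]; simp
    have hexp2 : Real.exp 1 ^ 2 ≤ X :=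
      le_trans (le_trans (pow_le_pow_left₀ (Real.exp_pos 1).le Real.exp_one_lt_d9.le 2) (by norm_num)) hX64
    have he1 : Real.exp 1 ≤ X₀ := by
      refine le_trans ?_ hX₀
      rw [← Real.sqrt_sq (Real.exp_pos 1).le]
      exact Real.sqrt_le_sqrt hexp2
    have h1 := J_add_one_le I hη hη1 he1
    have h2 : Real.log (Real.log X₀) ≤ lam := by
      have hX₀1 : 1 ≤ Real.log X₀ := by
        rw [← Real.log_exp 1]; exact Real.log_le_log (Real.exp_pos 1) he1
      exact Real.log_le_log (by linarith) (Real.log_le_log hX₀0 hX₀X)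
    rw [hJrdef, hcard]; linarith
  have hρ₀ : 0 ≤ ρ₁ := Real.sqrt_nonneg _
  have hρ : ρ₁ ≤ 2 * Real.exp (-(lam / 4)) := by
    have h1 : (Real.log Q + 2) / ℓ₁ ≤ 2 * ((Real.sqrt ℓ + 2) / ℓ) := by
      rw [hQdef, Real.log_exp, div_le_iff₀ hℓ₁0]
      have h0 : 0 ≤ Real.sqrt ℓ + 2 := by positivity
      have e : 2 * ((Real.sqrt ℓ + 2) / ℓ) * ℓ₁ = (Real.sqrt ℓ + 2) * (2 * ℓ₁ / ℓ) := by ring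
      rw [e]
      have : 1 ≤ 2 * ℓ₁ / ℓ := by rw [le_div_iff₀ hℓ0]; linarith
      nlinarith
    have h2 := sqrt_ratio_le hℓ4
    rw [← hlamdef] at h2
    calc ρ₁ ≤ Real.sqrt (2 * ((Real.sqrt ℓ + 2) / ℓ)) := Real.sqrt_le_sqrt h1
      _ = Real.sqrt 2 * Real.sqrt ((Real.sqrt ℓ + 2) / ℓ) := Real.sqrt_mul (by norm_num) _
      _ ≤ Real.sqrt 2 * (Real.sqrt 2 * Real.exp (-(lam / 4))) :=
          mul_le_mul_of_nonneg_left h2 (Real.sqrt_nonneg _)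
      _ = 2 * Real.exp (-(lam / 4)) := by
          rw [← mul_assoc, Real.mul_self_sqrt (by norm_num)]
  have hs0 : 0 ≤ s := by positivity
  have hsℓ : Real.sqrt ℓ = Real.exp (lam / 2) := by
    rw [hℓexp, Real.sqrt_eq_rpow, ← Real.exp_mul]; ring_nf
  have hs : s ≤ Real.sqrt 2 * Real.exp (-(lam / 2)) := by
    have h1 : Real.sqrt (ℓ / 2) ≤ Real.sqrt ℓ₁ := Real.sqrt_le_sqrt hℓ₁ℓ
    have h2 : s ≤ 1 / Real.sqrt (ℓ / 2) :=
      one_div_le_one_div_of_le (Real.sqrt_pos.2 (by linarith)) h1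
    have h3 : 1 / Real.sqrt (ℓ / 2) = Real.sqrt 2 * Real.exp (-(lam / 2)) := by
      rw [Real.sqrt_div' ℓ (by norm_num : (0:ℝ) ≤ 2), hsℓ, Real.exp_neg]
      field_simp
    linarith [h3 ▸ h2]
  have hc : c ≤ 2 * Real.exp (-(15 / 16 * lam)) := by
    rw [hcdef, hLexp, div_le_iff₀ hℓ₁0]
    have e : Real.exp (lam / 16) = 2 * Real.exp (-(15 / 16 * lam)) * (Real.exp lam / 2) := by
      rw [show (lam / 16) = -(15 / 16 * lam) + lam by ring, Real.exp_add]; ring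
    rw [e, ← hℓexp]
    exact mul_le_mul_of_nonneg_left hℓ₁ℓ (by positivity)
  have hEcard : (E.card : ℝ) ≤ Q := (card_biUnion_primeBlock_le I hη hη8).trans hQJ
  have hd : d ≤ 4 * Real.exp (-(15 / 16 * lam)) := by
    -- `d ≤ L (Q + 15)/X ≤ 4 L Q/X`, `Q/X ≤ e^{√ℓ - ℓ} ≤ e^{-ℓ/2} ≤ e^{-λ}`
    have h1 : d ≤ L * (4 * Q) / X := by
      rw [hddef]
      refine div_le_div_of_nonneg_right (mul_le_mul_of_nonneg_left (by linarith) hL0.le) hX0.le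
    have hXexp : X = Real.exp ℓ := by rw [hℓdef, Real.exp_log hX0]
    have h2 : Q / X ≤ Real.exp (-lam) := by
      rw [hXexp, hQdef, ← Real.exp_sub]
      refine Real.exp_le_exp.2 ?_
      -- `√ℓ - ℓ ≤ -λ`: `λ ≤ 2√ℓ ≤ ℓ - √ℓ` since `√ℓ ≥ 4`... use `λ = log ℓ ≤ 2 √ℓ` and `3√ℓ ≤ ℓ` (`√ℓ ≥ 4`)
      have hl : lam ≤ 2 * Real.sqrt ℓ := by
        have := Real.log_le_rpow_div hℓ0.le (by norm_num : (0:ℝ) < 1 / 2)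
        rw [← Real.sqrt_eq_rpow, ← hlamdef] at this; linarith
      have hs4 : 4 ≤ Real.sqrt ℓ := by
        rw [show (4 : ℝ) = Real.sqrt 16 by rw [show (16:ℝ) = 4 ^ 2 by norm_num, Real.sqrt_sq (by norm_num)]]
        exact Real.sqrt_le_sqrt hℓ16
      nlinarith [Real.mul_self_sqrt hℓ0.le]
    calc d ≤ L * (4 * Q) / X := h1
      _ = 4 * L * (Q / X) := by ring
      _ ≤ 4 * L * Real.exp (-lam) := mul_le_mul_of_nonneg_left h2 (by positivity)
      _ = 4 * Real.exp (-(15 / 16 * lam)) := by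
          rw [hLexp, mul_assoc, ← Real.exp_add]; congr 1; congr 1; ring
  have herr := windowSq_errTerms_le hlam0 hJr hρ₀ hρ hs0 hs hc hd
  -- identify the error term of `hmain`
  have hGeq : Jr * ρ₁ + Jr * L * δ₀ ^ (-(1 / 12 : ℝ)) / Real.sqrt ℓ₁ + c + d + L * δ₀ =
      Jr * ρ₁ + Jr * Real.exp (lam / 16) * (Real.exp (-(lam / 16 + lam / 100))) ^ (-(1 / 12 : ℝ)) * s + c + d +
        Real.exp (lam / 16) * Real.exp (-(lam / 16 + lam / 100)) := by
    rw [hsdef, hδ₀def, hLexp]; ring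
  have hG0 : 0 ≤ Jr * ρ₁ + Jr * L * δ₀ ^ (-(1 / 12 : ℝ)) / Real.sqrt ℓ₁ + c + d + L * δ₀ := by
    have h1 : 0 ≤ Jr * ρ₁ := mul_nonneg hJr0 hρ₀
    have h2 : 0 ≤ Jr * L * δ₀ ^ (-(1 / 12 : ℝ)) / Real.sqrt ℓ₁ :=
      div_nonneg (mul_nonneg (mul_nonneg hJr0 hL0.le) (Real.rpow_nonneg hδ₀.le _)) (Real.sqrt_nonneg _)
    have h3 : 0 ≤ c := by rw [hcdef]; exact div_nonneg hL0.le hℓ₁0.le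
    have h4 : 0 ≤ d := by
      rw [hddef]
      exact div_nonneg (mul_nonneg hL0.le (add_nonneg (Nat.cast_nonneg _) (by norm_num))) hX0.le
    have h5 : 0 ≤ L * δ₀ := mul_nonneg hL0.le hδ₀.le
    linarith
  have hGle : Jr * ρ₁ + Jr * L * δ₀ ^ (-(1 / 12 : ℝ)) / Real.sqrt ℓ₁ + c + d + L * δ₀ ≤
      42 * Real.exp (-(lam / 100)) := by rw [hGeq]; exact herr
  have hGsq : (Jr * ρ₁ + Jr * L * δ₀ ^ (-(1 / 12 : ℝ)) / Real.sqrt ℓ₁ + c + d + L * δ₀) ^ 2 ≤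
      1764 * (1 / ℓ ^ (1 / 50 : ℝ)) := by
    have h1 := pow_le_pow_left₀ hG0 hGle 2
    have hE1 : Real.exp (-(lam / 100)) ^ 2 = Real.exp (-(lam / 50)) := by
      rw [← Real.exp_nat_mul]; congr 1; push_cast; ring
    have hE2 : 1 / ℓ ^ (1 / 50 : ℝ) = Real.exp (-(lam / 50)) := by
      rw [Real.rpow_def_of_pos hℓ0, one_div, ← Real.exp_neg, hlamdef]; ring_nf
    have hE : (42 * Real.exp (-(lam / 100))) ^ 2 = 1764 * (1 / ℓ ^ (1 / 50 : ℝ)) := by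
      rw [mul_pow, hE1, hE2]; norm_num
    rw [← hE]; exact h1
  have hpeak := sq_peak_le hM0
  rw [← hM₀def] at hpeak
  -- assemble
  have hiE : 0 ≤ 1 / ℓ ^ (1 / 50 : ℝ) := div_nonneg zero_le_one (Real.rpow_nonneg hℓ0.le _)
  have hP0 : 0 ≤ (1 + M) ^ 2 * Real.exp (-M) := mul_nonneg (sq_nonneg _) (Real.exp_pos _).le
  calc K * (((1 + M₀) * Real.exp (-M₀)) ^ 2 +
        (Jr * ρ₁ + Jr * L * δ₀ ^ (-(1 / 12 : ℝ)) / Real.sqrt ℓ₁ + c + d + L * δ₀) ^ 2)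
      ≤ K * (3 * ((1 + M) ^ 2 * Real.exp (-M)) + 1764 * (1 / ℓ ^ (1 / 50 : ℝ))) := by
        refine mul_le_mul_of_nonneg_left ?_ hK0.le
        linarith
    _ ≤ K * 1764 * ((1 + M) ^ 2 * Real.exp (-M) + 1 / ℓ ^ (1 / 50 : ℝ)) := by
        have := mul_nonneg hK0.le hP0
        nlinarith

/-- **The window `|t - t₁| ≤ (log X)^{1/16}` of Proposition A.3 for the restricted polynomial, in `L²`, final form**
(unconditional).  There is an absolute `K` such that for all large `X`, every `0 < η ≤ 1`, every interval system
`I : SieveIntervalSystem η X₀` with `√X ≤ X₀ ≤ X`, every completely multiplicative `f` with `|f| ≤ 1`, every `t₁` and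
every `[a, b] ⊆ [t₁ - (log X)^{1/16}, t₁ + (log X)^{1/16}] ∩ [-X/2, X/2]`,
`∫_a^b |F(1+it)|² dt ≤ K ((1 + M)² e^{-M} + (log X)^{-1/50})`, `F(1+it) = MRT2015.restrDirichlet f I X t`,
`M = M(f; X)`. [cite: MatomakiRadziwillTao2015, Appendix A, Proposition A.3 (proof)] -/
theorem integral_sq_restrDirichlet_window_le_sq :
    ∃ K : ℝ, 0 < K ∧ ∀ᶠ X : ℝ in atTop, ∀ (η X₀ : ℝ) (I : SieveIntervalSystem η X₀) (f : ℕ → ℂ),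
      0 < η → η ≤ 1 → (∀ m n, f (m * n) = f m * f n) → f 1 = 1 → (∀ n, ‖f n‖ ≤ 1) →
      Real.sqrt X ≤ X₀ → X₀ ≤ X →
      ∀ (t₁ a b : ℝ),
        a ≤ b → t₁ - Real.log X ^ (1 / 16 : ℝ) ≤ a → b ≤ t₁ + Real.log X ^ (1 / 16 : ℝ) →
        -(X / 2) ≤ a → b ≤ X / 2 →
        ∫ t in a..b, ‖restrDirichlet f I X t‖ ^ 2 ≤
          K * ((1 + minPretentiousDistSq f X X) ^ 2 * Real.exp (-minPretentiousDistSq f X X) +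
            1 / Real.log X ^ (1 / 50 : ℝ)) :=
  integral_sq_restrDirichlet_window_le_sq_of Halasz.Restricted.integral_sq_restr_dirichlet_window_sq_le

end MRT2015

end Literature.NumberTheory.LFunctions
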